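import Summits.KontsevichZagierPeriods.KontsevichZagierPeriods.Theorems.LinRedNormalFormArrangementNormalFormSeparateThreeHHKMass
import Summits.KontsevichZagierPeriods.KontsevichZagierPeriods.Theorems.LinRedNormalFormArrangementNormalFormSeparateThreeHHKChart
import Summits.KontsevichZagierPeriods.KontsevichZagierPeriods.Theorems.LinRedNormalFormArrangementNormalFormSeparateTwoHIWeight

/-!
# The weight on a nested thin sector: fibre-mass hypotheses and weight algebra

(Line `janus-bands`, crux `ArrangementNormalForm`, stub `stub_separateHigh`, part `HHKWeight` of
the wall-invariant termwise-split lemma `separateThree_hHk` in base dimension `3` with fibres.)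
For a literal Janus fibre datum (`lo`, `hi`, `a` over atoms `SepTwo.Atm 3`) and a nested thin
sector at the base point `z₁ ∈ ℝ³` with frame `d, Q, S` (part `HHKChart`), every atom value along
the sector is `av z₁ c + t (p c + v (q c + u · r c))` (`av_npt`), the format of part `HHKMass`;
hence the fibre mass in blown-up coordinates `Λ'(t, v, u) = lmass lo hi a (av (npt z₁ d Q S t v u))`
is, on all small scales, almost decreasing towards the corner at ratio `4` and has logarithmic
contraction costs in each of `t, v, u` (`weight_hyps3`, registered as `separateThreeHHK_weight`).
The full weight of the ray theorems is `wt3 = ofReal (t² v / (t^Dt v^Dv u^Du ω)) · Λ'` with a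
two-sided bounded regular factor `ω`; this file also proves its ratio-`4` monotonicity
(`wt3_mono`) and its logarithmic costs in the variables carrying no explicit power
(`wt3_tlog`, `wt3_vlog`, `wt3_ulog`).
-/

noncomputable section

open Set MeasureTheory
open scoped ENNReal

namespace Summit.KontsevichZagierPeriods.ArrangementNormalForm.JanusBands

namespace SepHHK

open SepTwo

variable {k : ℕ}

/-! ### Atoms along a nested sector -/

/-- Atom values along a nested thin sector. -/
theorem av_npt (z₁ d Q S : Fin 3 → ℝ) (t v u : ℝ) (c : Atm 3) :
    av (npt z₁ d Q S t v u) c = av z₁ c + t * ((∑ i, (c.1 i : ℝ) * d i) +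
      v * ((∑ i, (c.1 i : ℝ) * Q i) + u * (∑ i, (c.1 i : ℝ) * S i))) := by
  simp only [av, npt, Fin.sum_univ_three]
  ring

/-- **The fibre mass along a nested sector is jointly measurable.** -/
theorem measurable_lmass_npt (lo hi : Fin k → Fin k ⊕ Atm 3) (a : Fin k → Option (Atm 3))
    (z₁ d Q S : Fin 3 → ℝ) :
    Measurable fun p : ℝ × ℝ × ℝ => lmass lo hi a (av (npt z₁ d Q S p.1 p.2.1 p.2.2)) :=
  (measurable_lmass_av lo hi a).comp (continuous_npt z₁ d Q S).measurable

/-- Three real functions on a finite set are bounded by some `R > 0`. -/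
theorem exists_bound_const3 {ι : Type*} (U : Finset ι) (p q r : ι → ℝ) :
    ∃ R : ℝ, 0 < R ∧ (∀ c ∈ U, |p c| ≤ R) ∧ (∀ c ∈ U, |q c| ≤ R) ∧ ∀ c ∈ U, |r c| ≤ R := by
  obtain ⟨R₁, hR₁, hp, hq⟩ := exists_bound_const U p q
  obtain ⟨R₂, hR₂, hr, -⟩ := exists_bound_const U r r
  refine ⟨R₁ + R₂, by positivity, fun c hc => (hp c hc).trans (by linarith),
    fun c hc => (hq c hc).trans (by linarith), fun c hc => (hr c hc).trans (by linarith)⟩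

/-- Comparing the admissible ranges of the contraction lemmas. -/
theorem div_le_div_denom {G a b : ℝ} (hG : 0 < G) (ha : 0 < a) (hab : a ≤ b) : G / b ≤ G / a :=
  div_le_div_of_nonneg_left hG.le ha hab

/-- **The weight hypotheses for the fibre mass along a nested thin sector.** See the module
docstring. -/
theorem weight_hyps3 (lo hi : Fin k → Fin k ⊕ Atm 3) (a : Fin k → Option (Atm 3))
    (z₁ d Q S : Fin 3 → ℝ) :
    ∃ δ₀ > 0, ∃ ε₀ > 0, ∃ η₀ > 0, ∃ KΛ : ℝ≥0∞, KΛ ≠ ∞ ∧ ∃ Kn : ℕ, ∃ CΛ : ℝ≥0∞, CΛ ≠ ∞ ∧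
      (∀ δt δ ε : ℝ, 4 * δt ≤ δ₀ → 4 * δ ≤ ε₀ → 4 * ε ≤ η₀ →
        ∀ t v u t' v' u' : ℝ, 0 < t → t ≤ t' → t' ≤ 4 * t → t' < 4 * δt → 0 < v → v ≤ v' →
          v' ≤ 4 * v → v' < 4 * δ → 0 < u → u ≤ u' → u' ≤ 4 * u → u' < 4 * ε →
          lmass lo hi a (av (npt z₁ d Q S t v u)) ≤ KΛ * lmass lo hi a (av (npt z₁ d Q S t' v' u'))) ∧
      (∀ δt δ ε : ℝ, δt ≤ δ₀ → δ ≤ ε₀ → ε ≤ η₀ → ∀ v, 0 < v → v < δ → ∀ u, 0 < u → u < ε →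
        ∀ t t', 0 < t → t ≤ t' → t' < δt → lmass lo hi a (av (npt z₁ d Q S t v u)) ≤
          CΛ * ENNReal.ofReal ((1 + Real.log (t' / t)) ^ Kn) *
            lmass lo hi a (av (npt z₁ d Q S t' v u))) ∧
      (∀ δt δ ε : ℝ, δt ≤ δ₀ → δ ≤ ε₀ → ε ≤ η₀ → ∀ t, 0 < t → t < δt → ∀ u, 0 < u → u < ε →
        ∀ v v', 0 < v → v ≤ v' → v' < δ → lmass lo hi a (av (npt z₁ d Q S t v u)) ≤
          CΛ * ENNReal.ofReal ((1 + Real.log (v' / v)) ^ Kn) *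
            lmass lo hi a (av (npt z₁ d Q S t v' u))) ∧
      (∀ δt δ ε : ℝ, δt ≤ δ₀ → δ ≤ ε₀ → ε ≤ η₀ → ∀ t, 0 < t → t < δt → ∀ v, 0 < v → v < δ →
        ∀ u u', 0 < u → u ≤ u' → u' < ε → lmass lo hi a (av (npt z₁ d Q S t v u)) ≤
          CΛ * ENNReal.ofReal ((1 + Real.log (u' / u)) ^ Kn) *
            lmass lo hi a (av (npt z₁ d Q S t v u'))) := by
  obtain ⟨U, hlo, hhi, ha⟩ := exists_atoms lo hi a
  set c₀ : Atm 3 → ℝ := fun c => av z₁ c with hc₀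
  set p : Atm 3 → ℝ := fun c => ∑ i, (c.1 i : ℝ) * d i with hp
  set q : Atm 3 → ℝ := fun c => ∑ i, (c.1 i : ℝ) * Q i with hq
  set r : Atm 3 → ℝ := fun c => ∑ i, (c.1 i : ℝ) * S i with hr
  have hΛ : ∀ t v u, lmass lo hi a (av (npt z₁ d Q S t v u)) =
      lmass lo hi a (fun c => c₀ c + t * (p c + v * (q c + u * r c))) := fun t v u => by
    congr 1
    funext c
    exact av_npt z₁ d Q S t v u c
  obtain ⟨G, hG, hGsep⟩ := exists_sep_const U c₀
  obtain ⟨g, hg, hgsep⟩ := exists_sep_const U p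
  obtain ⟨g', hg', hg'sep⟩ := exists_sep_const U q
  obtain ⟨R, hR, hRp, hRq, hRr⟩ := exists_bound_const3 U p q r
  set Kn := k * U.card with hKn
  have h56 : G / (56 * R) ≤ G / (28 * R) := div_le_div_denom hG (by positivity) (by linarith)
  have h28 : g / (28 * R) ≤ g / (16 * R) := div_le_div_denom hg (by positivity) (by linarith)
  refine ⟨G / (56 * R), by positivity, min 1 (g / (28 * R)), by positivity,
    min 1 (g' / (14 * R)), by positivity,
    (9 : ℝ≥0∞) ^ Kn * (9 : ℝ≥0∞) ^ Kn * (9 : ℝ≥0∞) ^ Kn,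
    ENNReal.mul_ne_top (ENNReal.mul_ne_top (ENNReal.pow_ne_top (by norm_num))
      (ENNReal.pow_ne_top (by norm_num))) (ENNReal.pow_ne_top (by norm_num)),
    Kn, ENNReal.ofReal (5 ^ Kn), ENNReal.ofReal_ne_top, ?_, ?_, ?_, ?_⟩
  · intro δt δ ε hδt hδ hε t v u t' v' u' ht htt' ht't ht' hv hvv' hv'v hv' hu huu' hu'u hu'
    rw [hΛ, hΛ]
    have hv'1 : v' ≤ 1 := by linarith [min_le_left 1 (g / (28 * R))]
    have hv'g : v' ≤ g / (28 * R) := by linarith [min_le_right 1 (g / (28 * R))]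
    have hu'1 : u' ≤ 1 := by linarith [min_le_left 1 (g' / (14 * R))]
    have hu'g : u' ≤ g' / (14 * R) := by linarith [min_le_right 1 (g' / (14 * R))]
    exact lmass_corner_mono3 lo hi a U hlo hhi ha c₀ p q r G g g' R hR hGsep hgsep hg'sep hRp hRq hRr
      ht htt' ht't (by linarith) hv hvv' hv'v hv'1 hv'g hu huu' hu'u hu'1 hu'g
  · intro δt δ ε hδt hδ hε v hv hvδ u hu huε t t' ht htt' ht'
    rw [hΛ, hΛ]
    have hv1 : |v| ≤ 1 := by
      rw [abs_of_pos hv]; linarith [min_le_left 1 (g / (28 * R))]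
    have hu1 : |u| ≤ 1 := by
      rw [abs_of_pos hu]; linarith [min_le_left 1 (g' / (14 * R))]
    have h := lmass_tlog3 lo hi a U hlo hhi ha c₀ p q r G R hR hGsep hRp hRq hRr ht htt'
      (by linarith) hv1 hu1
    rwa [ofReal_five_mul_pow (one_add_log_nonneg ht htt')] at h
  · intro δt δ ε hδt hδ hε t ht htδ u hu huε v v' hv hvv' hv'
    rw [hΛ, hΛ]
    have hv'1 : v' ≤ 1 := by linarith [min_le_left 1 (g / (28 * R))]
    have hv'g : v' ≤ g / (28 * R) := by linarith [min_le_right 1 (g / (28 * R))]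
    have hu1 : |u| ≤ 1 := by
      rw [abs_of_pos hu]; linarith [min_le_left 1 (g' / (14 * R))]
    have h := lmass_vlog3 lo hi a U hlo hhi ha c₀ p q r G g R hR hGsep hgsep hRp hRq hRr ht
      (by linarith) hv hvv' hv'1 hv'g hu1
    rwa [ofReal_five_mul_pow (one_add_log_nonneg hv hvv')] at h
  · intro δt δ ε hδt hδ hε t ht htδ v hv hvδ u u' hu huu' hu'
    rw [hΛ, hΛ]
    have hv1 : v ≤ 1 := by linarith [min_le_left 1 (g / (28 * R))]
    have hvg : v ≤ g / (16 * R) := by linarith [min_le_right 1 (g / (28 * R))]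
    have hu'1 : u' ≤ 1 := by linarith [min_le_left 1 (g' / (14 * R))]
    have hu'g : u' ≤ g' / (14 * R) := by linarith [min_le_right 1 (g' / (14 * R))]
    have h := lmass_ulog3 lo hi a U hlo hhi ha c₀ p q r G g g' R hR hGsep hgsep hg'sep hRp hRq hRr
      ht (by linarith) hv hv1 hvg hu huu' hu'1 hu'g
    rwa [ofReal_five_mul_pow (one_add_log_nonneg hu huu')] at h

/-! ### The weight and its algebra -/

/-- The scalar part of the weight: `t² v / (t^Dt v^Dv u^Du ω(t, v, u))`. -/
def phi3 (Dt Dv Du : ℕ) (ω : ℝ → ℝ → ℝ → ℝ) (t v u : ℝ) : ℝ :=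
  t ^ 2 * v / (t ^ Dt * v ^ Dv * u ^ Du * ω t v u)

/-- The weight `ofReal (phi3) · Λ'`. -/
def wt3 (Dt Dv Du : ℕ) (ω : ℝ → ℝ → ℝ → ℝ) (Λ' : ℝ → ℝ → ℝ → ℝ≥0∞) (t v u : ℝ) : ℝ≥0∞ :=
  ENNReal.ofReal (phi3 Dt Dv Du ω t v u) * Λ' t v u

/-- The weight is jointly measurable. -/
theorem measurable_wt3 (Dt Dv Du : ℕ) {ω : ℝ → ℝ → ℝ → ℝ}
    (hω : Measurable fun p : ℝ × ℝ × ℝ => ω p.1 p.2.1 p.2.2) {Λ' : ℝ → ℝ → ℝ → ℝ≥0∞}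
    (hΛ : Measurable fun p : ℝ × ℝ × ℝ => Λ' p.1 p.2.1 p.2.2) :
    Measurable fun p : ℝ × ℝ × ℝ => wt3 Dt Dv Du ω Λ' p.1 p.2.1 p.2.2 := by
  have h1 : Measurable fun p : ℝ × ℝ × ℝ => phi3 Dt Dv Du ω p.1 p.2.1 p.2.2 := by
    unfold phi3
    refine ((measurable_fst.pow_const 2).mul (measurable_fst.comp measurable_snd)).div ?_
    exact (((measurable_fst.pow_const Dt).mul ((measurable_fst.comp measurable_snd).pow_const Dv)).mul
      ((measurable_snd.comp measurable_snd).pow_const Du)).mul hω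
  exact (ENNReal.measurable_ofReal.comp h1).mul hΛ

/-- The ratio inequality for the scalar weight. -/
theorem phi3_le {Dt Dv Du : ℕ} {ω : ℝ → ℝ → ℝ → ℝ} {t v u t' v' u' K : ℝ}
    (hnum0 : 0 ≤ t ^ 2 * v) (hnum : t ^ 2 * v ≤ t' ^ 2 * v')
    (hden : 0 < t ^ Dt * v ^ Dv * u ^ Du * ω t v u)
    (hden' : 0 < t' ^ Dt * v' ^ Dv * u' ^ Du * ω t' v' u')
    (hK : t' ^ Dt * v' ^ Dv * u' ^ Du * ω t' v' u' ≤ K * (t ^ Dt * v ^ Dv * u ^ Du * ω t v u)) :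
    phi3 Dt Dv Du ω t v u ≤ K * phi3 Dt Dv Du ω t' v' u' := by
  unfold phi3
  have hK0 : 0 ≤ K := by
    by_contra h
    push Not at h
    nlinarith
  set den := t ^ Dt * v ^ Dv * u ^ Du * ω t v u with hden_def
  set den' := t' ^ Dt * v' ^ Dv * u' ^ Du * ω t' v' u' with hden'_def
  calc t ^ 2 * v / den ≤ t' ^ 2 * v' / den := div_le_div_of_nonneg_right hnum hden.le
    _ = t' ^ 2 * v' * (1 / den) := by rw [mul_one_div]
    _ ≤ t' ^ 2 * v' * (K / den') := by
        refine mul_le_mul_of_nonneg_left ?_ (hnum0.trans hnum)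
        rw [div_le_div_iff₀ hden hden', one_mul]
        exact hK
    _ = K * (t' ^ 2 * v' / den') := by ring

/-- The bounds of the regular factor give a positive factor and the ratio bound. -/
theorem omega_ratio {ω₁ ω₂ ωlo ωhi : ℝ} (hωlo : 0 < ωlo) (h1 : ωlo ≤ ω₁) (h2 : ω₂ ≤ ωhi)
    (h2lo : ωlo ≤ ω₂) : 0 < ω₁ ∧ 0 < ω₂ ∧ ω₂ ≤ ωhi / ωlo * ω₁ := by
  refine ⟨hωlo.trans_le h1, hωlo.trans_le h2lo, ?_⟩
  rw [div_mul_eq_mul_div, le_div_iff₀ hωlo]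
  exact mul_le_mul h2 h1 hωlo.le ((hωlo.trans_le h2lo).le.trans h2)

section Algebra

variable (Dt Dv Du : ℕ) {ω : ℝ → ℝ → ℝ → ℝ} {Λ' : ℝ → ℝ → ℝ → ℝ≥0∞} {δt δ ε ωlo ωhi : ℝ}
  (hωlo : 0 < ωlo)
  (hω : ∀ t ∈ Ioo (0 : ℝ) (4 * δt), ∀ v ∈ Ioo (0 : ℝ) (4 * δ), ∀ u ∈ Ioo (0 : ℝ) (4 * ε),
    ωlo ≤ ω t v u ∧ ω t v u ≤ ωhi)

include hωlo hω

/-- **The weight is almost decreasing towards the corner** at ratio `4`. -/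
theorem wt3_mono (KΛ : ℝ≥0∞)
    (hΛ : ∀ t v u t' v' u', 0 < t → t ≤ t' → t' ≤ 4 * t → t' < 4 * δt → 0 < v → v ≤ v' →
      v' ≤ 4 * v → v' < 4 * δ → 0 < u → u ≤ u' → u' ≤ 4 * u → u' < 4 * ε →
      Λ' t v u ≤ KΛ * Λ' t' v' u') :
    ∀ t v u t' v' u', 0 < t → t ≤ t' → t' ≤ 4 * t → t' < 4 * δt → 0 < v → v ≤ v' →
      v' ≤ 4 * v → v' < 4 * δ → 0 < u → u ≤ u' → u' ≤ 4 * u → u' < 4 * ε →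
      wt3 Dt Dv Du ω Λ' t v u ≤
        (ENNReal.ofReal (4 ^ Dt * 4 ^ Dv * 4 ^ Du * (ωhi / ωlo)) * KΛ) * wt3 Dt Dv Du ω Λ' t' v' u' := by
  intro t v u t' v' u' ht htt' ht't ht' hv hvv' hv'v hv' hu huu' hu'u hu'
  obtain ⟨hω1, -⟩ := hω t ⟨ht, by linarith⟩ v ⟨hv, by linarith⟩ u ⟨hu, by linarith⟩
  obtain ⟨hω1', hω2'⟩ := hω t' ⟨by linarith, ht'⟩ v' ⟨by linarith, hv'⟩ u' ⟨by linarith, hu'⟩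
  obtain ⟨hωpos, hωpos', hrat⟩ := omega_ratio hωlo hω1 hω2' hω1'
  have ht'0 : 0 < t' := ht.trans_le htt'
  have hv'0 : 0 < v' := hv.trans_le hvv'
  have hu'0 : 0 < u' := hu.trans_le huu'
  have hωhi : 0 < ωhi := hωpos'.trans_le hω2'
  have hden : 0 < t ^ Dt * v ^ Dv * u ^ Du * ω t v u := by positivity
  have hden' : 0 < t' ^ Dt * v' ^ Dv * u' ^ Du * ω t' v' u' := by positivity
  have hK : t' ^ Dt * v' ^ Dv * u' ^ Du * ω t' v' u' ≤
      (4 ^ Dt * 4 ^ Dv * 4 ^ Du * (ωhi / ωlo)) * (t ^ Dt * v ^ Dv * u ^ Du * ω t v u) := by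
    have h1 : t' ^ Dt ≤ 4 ^ Dt * t ^ Dt := by
      rw [← mul_pow]; exact pow_le_pow_left₀ (by linarith) ht't Dt
    have h2 : v' ^ Dv ≤ 4 ^ Dv * v ^ Dv := by
      rw [← mul_pow]; exact pow_le_pow_left₀ (by linarith) hv'v Dv
    have h3 : u' ^ Du ≤ 4 ^ Du * u ^ Du := by
      rw [← mul_pow]; exact pow_le_pow_left₀ (by linarith) hu'u Du
    calc t' ^ Dt * v' ^ Dv * u' ^ Du * ω t' v' u'
        ≤ (4 ^ Dt * t ^ Dt) * (4 ^ Dv * v ^ Dv) * (4 ^ Du * u ^ Du) * (ωhi / ωlo * ω t v u) := by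
          refine mul_le_mul (mul_le_mul (mul_le_mul h1 h2 (by positivity) (by positivity)) h3
            (by positivity) (by positivity)) hrat hωpos'.le (by positivity)
      _ = _ := by ring
  have hφ := phi3_le (by positivity) (by nlinarith [mul_le_mul htt' htt' ht.le (by linarith)])
    hden hden' hK
  unfold wt3
  calc ENNReal.ofReal (phi3 Dt Dv Du ω t v u) * Λ' t v u
      ≤ ENNReal.ofReal ((4 ^ Dt * 4 ^ Dv * 4 ^ Du * (ωhi / ωlo)) * phi3 Dt Dv Du ω t' v' u') *
          (KΛ * Λ' t' v' u') :=
        mul_le_mul (ENNReal.ofReal_le_ofReal hφ)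
          (hΛ t v u t' v' u' ht htt' ht't ht' hv hvv' hv'v hv' hu huu' hu'u hu') zero_le zero_le
    _ = _ := by
        rw [ENNReal.ofReal_mul (by positivity)]; ring

/-- **Logarithmic cost in `u`** (no explicit power of `u`). -/
theorem wt3_ulog (hDu : Du = 0) (Kn : ℕ) (CΛ : ℝ≥0∞)
    (hΛ : ∀ t, 0 < t → t < δt → ∀ v, 0 < v → v < δ → ∀ u u', 0 < u → u ≤ u' → u' < ε →
      Λ' t v u ≤ CΛ * ENNReal.ofReal ((1 + Real.log (u' / u)) ^ Kn) * Λ' t v u') :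
    ∀ t, 0 < t → t < δt → ∀ v, 0 < v → v < δ → ∀ u u', 0 < u → u ≤ u' → u' < ε →
      wt3 Dt Dv Du ω Λ' t v u ≤ (ENNReal.ofReal (ωhi / ωlo) * CΛ) *
        ENNReal.ofReal ((1 + Real.log (u' / u)) ^ Kn) * wt3 Dt Dv Du ω Λ' t v u' := by
  subst hDu
  intro t ht htδ v hv hvδ u u' hu huu' hu'
  have hε : 0 < ε := hu.trans (huu'.trans_lt hu')
  obtain ⟨hω1, -⟩ := hω t ⟨ht, by linarith⟩ v ⟨hv, by linarith⟩ u ⟨hu, by linarith⟩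
  obtain ⟨hω1', hω2'⟩ := hω t ⟨ht, by linarith⟩ v ⟨hv, by linarith⟩ u' ⟨by linarith, by linarith⟩
  obtain ⟨hωpos, hωpos', hrat⟩ := omega_ratio hωlo hω1 hω2' hω1'
  have hωhi : 0 < ωhi := hωpos'.trans_le hω2'
  have hden : 0 < t ^ Dt * v ^ Dv * u ^ 0 * ω t v u := by positivity
  have hden' : 0 < t ^ Dt * v ^ Dv * u' ^ 0 * ω t v u' := by positivity
  have hK : t ^ Dt * v ^ Dv * u' ^ 0 * ω t v u' ≤ (ωhi / ωlo) * (t ^ Dt * v ^ Dv * u ^ 0 * ω t v u) := by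
    simp only [pow_zero, mul_one]
    calc t ^ Dt * v ^ Dv * ω t v u' ≤ t ^ Dt * v ^ Dv * (ωhi / ωlo * ω t v u) :=
          mul_le_mul_of_nonneg_left hrat (by positivity)
      _ = _ := by ring
  have hφ := phi3_le (by positivity) le_rfl hden hden' hK
  unfold wt3
  calc ENNReal.ofReal (phi3 Dt Dv 0 ω t v u) * Λ' t v u
      ≤ ENNReal.ofReal ((ωhi / ωlo) * phi3 Dt Dv 0 ω t v u') *
          (CΛ * ENNReal.ofReal ((1 + Real.log (u' / u)) ^ Kn) * Λ' t v u') :=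
        mul_le_mul (ENNReal.ofReal_le_ofReal hφ) (hΛ t ht htδ v hv hvδ u u' hu huu' hu') zero_le
          zero_le
    _ = _ := by
        rw [ENNReal.ofReal_mul (by positivity)]; ring

/-- **Logarithmic cost in `v`** (no explicit power of `v`). -/
theorem wt3_vlog (hDv : Dv = 0) (Kn : ℕ) (CΛ : ℝ≥0∞)
    (hΛ : ∀ t, 0 < t → t < δt → ∀ u, 0 < u → u < ε → ∀ v v', 0 < v → v ≤ v' → v' < δ →
      Λ' t v u ≤ CΛ * ENNReal.ofReal ((1 + Real.log (v' / v)) ^ Kn) * Λ' t v' u) :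
    ∀ t, 0 < t → t < δt → ∀ u, 0 < u → u < ε → ∀ v v', 0 < v → v ≤ v' → v' < δ →
      wt3 Dt Dv Du ω Λ' t v u ≤ (ENNReal.ofReal (ωhi / ωlo) * CΛ) *
        ENNReal.ofReal ((1 + Real.log (v' / v)) ^ Kn) * wt3 Dt Dv Du ω Λ' t v' u := by
  subst hDv
  intro t ht htδ u hu huε v v' hv hvv' hv'
  have hδ : 0 < δ := hv.trans (hvv'.trans_lt hv')
  obtain ⟨hω1, -⟩ := hω t ⟨ht, by linarith⟩ v ⟨hv, by linarith⟩ u ⟨hu, by linarith⟩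
  obtain ⟨hω1', hω2'⟩ := hω t ⟨ht, by linarith⟩ v' ⟨by linarith, by linarith⟩ u ⟨hu, by linarith⟩
  obtain ⟨hωpos, hωpos', hrat⟩ := omega_ratio hωlo hω1 hω2' hω1'
  have hωhi : 0 < ωhi := hωpos'.trans_le hω2'
  have hv'0 : 0 < v' := hv.trans_le hvv'
  have hden : 0 < t ^ Dt * v ^ 0 * u ^ Du * ω t v u := by positivity
  have hden' : 0 < t ^ Dt * v' ^ 0 * u ^ Du * ω t v' u := by positivity
  have hK : t ^ Dt * v' ^ 0 * u ^ Du * ω t v' u ≤ (ωhi / ωlo) * (t ^ Dt * v ^ 0 * u ^ Du * ω t v u) := by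
    simp only [pow_zero, mul_one]
    calc t ^ Dt * u ^ Du * ω t v' u ≤ t ^ Dt * u ^ Du * (ωhi / ωlo * ω t v u) :=
          mul_le_mul_of_nonneg_left hrat (by positivity)
      _ = _ := by ring
  have hφ := phi3_le (by positivity) (mul_le_mul_of_nonneg_left hvv' (by positivity)) hden hden' hK
  unfold wt3
  calc ENNReal.ofReal (phi3 Dt 0 Du ω t v u) * Λ' t v u
      ≤ ENNReal.ofReal ((ωhi / ωlo) * phi3 Dt 0 Du ω t v' u) *
          (CΛ * ENNReal.ofReal ((1 + Real.log (v' / v)) ^ Kn) * Λ' t v' u) :=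
        mul_le_mul (ENNReal.ofReal_le_ofReal hφ) (hΛ t ht htδ u hu huε v v' hv hvv' hv') zero_le
          zero_le
    _ = _ := by
        rw [ENNReal.ofReal_mul (by positivity)]; ring

/-- **Logarithmic cost in `t`** (no explicit power of `t`). -/
theorem wt3_tlog (hDt : Dt = 0) (Kn : ℕ) (CΛ : ℝ≥0∞)
    (hΛ : ∀ v, 0 < v → v < δ → ∀ u, 0 < u → u < ε → ∀ t t', 0 < t → t ≤ t' → t' < δt →
      Λ' t v u ≤ CΛ * ENNReal.ofReal ((1 + Real.log (t' / t)) ^ Kn) * Λ' t' v u) :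
    ∀ v, 0 < v → v < δ → ∀ u, 0 < u → u < ε → ∀ t t', 0 < t → t ≤ t' → t' < δt →
      wt3 Dt Dv Du ω Λ' t v u ≤ (ENNReal.ofReal (ωhi / ωlo) * CΛ) *
        ENNReal.ofReal ((1 + Real.log (t' / t)) ^ Kn) * wt3 Dt Dv Du ω Λ' t' v u := by
  subst hDt
  intro v hv hvδ u hu huε t t' ht htt' ht'
  have hδt : 0 < δt := ht.trans (htt'.trans_lt ht')
  obtain ⟨hω1, -⟩ := hω t ⟨ht, by linarith⟩ v ⟨hv, by linarith⟩ u ⟨hu, by linarith⟩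
  obtain ⟨hω1', hω2'⟩ := hω t' ⟨by linarith, by linarith⟩ v ⟨hv, by linarith⟩ u ⟨hu, by linarith⟩
  obtain ⟨hωpos, hωpos', hrat⟩ := omega_ratio hωlo hω1 hω2' hω1'
  have hωhi : 0 < ωhi := hωpos'.trans_le hω2'
  have ht'0 : 0 < t' := ht.trans_le htt'
  have hden : 0 < t ^ 0 * v ^ Dv * u ^ Du * ω t v u := by positivity
  have hden' : 0 < t' ^ 0 * v ^ Dv * u ^ Du * ω t' v u := by positivity
  have hK : t' ^ 0 * v ^ Dv * u ^ Du * ω t' v u ≤ (ωhi / ωlo) * (t ^ 0 * v ^ Dv * u ^ Du * ω t v u) := by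
    simp only [pow_zero, one_mul]
    calc v ^ Dv * u ^ Du * ω t' v u ≤ v ^ Dv * u ^ Du * (ωhi / ωlo * ω t v u) :=
          mul_le_mul_of_nonneg_left hrat (by positivity)
      _ = _ := by ring
  have hφ := phi3_le (by positivity)
    (mul_le_mul_of_nonneg_right (pow_le_pow_left₀ ht.le htt' 2) hv.le) hden hden' hK
  unfold wt3
  calc ENNReal.ofReal (phi3 0 Dv Du ω t v u) * Λ' t v u
      ≤ ENNReal.ofReal ((ωhi / ωlo) * phi3 0 Dv Du ω t' v u) *
          (CΛ * ENNReal.ofReal ((1 + Real.log (t' / t)) ^ Kn) * Λ' t' v u) :=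
        mul_le_mul (ENNReal.ofReal_le_ofReal hφ) (hΛ v hv hvδ u hu huε t t' ht htt' ht') zero_le
          zero_le
    _ = _ := by
        rw [ENNReal.ofReal_mul (by positivity)]; ring

end Algebra

end SepHHK

/-- **The weight hypotheses for the fibre mass along a nested thin sector** (registered part of
`stub_separateHigh`, base dimension `3` with fibres; literal form of the monotonicity clause of
`SepHHK.weight_hyps3`): the fibre mass of a literal Janus fibre datum at the points
`z₁ + t (d + v (Q + u S))` of a nested thin sector is, on all small scales, almost decreasing
towards the corner at ratio `4` in each of the three blow-up variables. -/
theorem separateThreeHHK_weight (k : ℕ) (lo hi : Fin k → Fin k ⊕ ((Fin 3 → ℚ) × ℚ)) (a : Fin k → Option ((Fin 3 → ℚ) × ℚ)) (z₁ d Q S : Fin 3 → ℝ) : ∃ δ₀ > 0, ∃ ε₀ > 0, ∃ η₀ > 0, ∃ KΛ : ENNReal, KΛ ≠ ⊤ ∧ ∀ δt δ ε : ℝ, 4 * δt ≤ δ₀ → 4 * δ ≤ ε₀ → 4 * ε ≤ η₀ → ∀ t v u t' v' u' : ℝ, 0 < t → t ≤ t' → t' ≤ 4 * t → t' < 4 *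 δt → 0 < v → v ≤ v' → v' ≤ 4 * v → v' < 4 * δ → 0 < u → u ≤ u' → u' ≤ 4 * u → u' < 4 * ε → SepTwo.lmass lo hi a (fun c : (Fin 3 → ℚ) × ℚ => ∑ i, (c.1 i : ℝ) * (z₁ i + t * (d i + v * (Q i + u * S i))) + (c.2 : ℝ)) ≤ KΛ * SepTwo.lmass lo hi a (fun c : (Fin 3 → ℚ) × ℚ => ∑ i, (c.1 i : ℝ) * (z₁ i + t' * (d i + v' * (Q i + u' * S i))) + (c.2 : ℝ)) := by
  obtain ⟨δ₀, hδ₀, ε₀, hε₀, η₀, hη₀, KΛ, hKΛ, Kn, CΛ, -, hmono, -⟩ :=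
    SepHHK.weight_hyps3 lo hi a z₁ d Q S
  exact ⟨δ₀, hδ₀, ε₀, hε₀, η₀, hη₀, KΛ, hKΛ, hmono⟩

end Summit.KontsevichZagierPeriods.ArrangementNormalForm.JanusBands
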